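import Summits.ABC.StewartYu.KummerBasisChange
import Summits.ABC.StewartYu.PadicTwoSetup
import Literature.Barriers.ABC.BakerMethodBoundsYuInputProofs
import HarnessLib

/-!
# Cell abc-stewartyu, Gen-3 frame at `p = 2` (crux `Y07Two`, stmt-ABC-19659): MATVEEV'S INDUCTION SHELL —
# the rank-indexed internal statement, the per-rank dichotomy, and the frozen engine text from the core

`Summits/ABC/StewartYu/GenThreeInductionTwo.lean` — cell `abc-stewartyu` (HOME
`run/shared/lean/pub/abc-stewartyu/`), route `PadicPrimesKummerThird`, seat p3 (g5), F-two LEAD of the crux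
`Y07Two`.  Theorems and two plain `Prop`-valued definitions (the interface of record D-F1 of
HOME/plan/m3/ZE-INTERFACE.md §F, typed); no named fact, place-light (the only `2`-adic input is the
monotonicity `ord₂(x − 1) ≤ ord₂(xᵏ − 1)` of `Literature.Barriers.ABC.padicValRat_sub_one_le_zpow_sub_one`).

## What this file pins down

Matveev's proof of the `cⁿ`-quality bound (Nesterenko 2003, Thm 2.1 via Prop. 2.6; Yu 2007/2013 at the
finite place) is an INDUCTION ON THE NUMBER OF LOGARITHMS: at rank `n`, either the analytic argument
(auxiliary polynomial, extrapolation with Kummer descent, zero estimate) yields the bound directly, or the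
zero estimate's obstruction subgroup produces — through the lattice lever and the re-basing of the
character lattice (`Summit.ABC.StewartYu.MatveevStepData.exists_matveev_step_data`) — a NEW linear form in
`r < n` logarithms `θᵢ = ∏ⱼ αⱼ^{Zᵢⱼ}` with `∏ θᵢ^{mᵢ} = (∏ αⱼ^{bⱼ})^{m₀}`, `m₀ ≠ 0`, whose weights satisfy the
cost inequality `C(r)·∏A′·(W′ + log 2A′max) ≤ C(n)·∏V·(W + log 2Vmax)` (Nesterenko (5.22); the record's
line).  Since `ord₂((∏ αᵇ)^{m₀} − 1) ≥ ord₂(∏ αᵇ − 1)` for a principal unit, the induction hypothesis at rank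
`r` closes the step.

The internal statement must be stable under that change of generators, which the frozen crux-side text
`GenThreeEngineTwo` (INTEGER generators, cube-Kummer in `ℕ`-contrapositive form) is not (`θᵢ` are rational,
not integral).  Decision D-F1 (planner g7 / p3-g4, 2026-08-26): the internal statement is

* `CoreTwo C r` — for RATIONAL `2`-adic principal units `θᵢ ≡ 1 (mod 8)` (`3 ≤ ord₂(θᵢ − 1)`),
  multiplicatively independent, `3`-Kummer in `ℤ`-divisibility form (`∏ θᵢ^{κᵢ} = γ³ ⇒ 3 ∣ κ`), weights
  `h(θᵢ) ≤ Aᵢ`, `1 ≤ Aᵢ ≤ Amax`, exponents `m ≠ 0` with `log max(3,|mᵢ|) ≤ W`, `1 ≤ W`: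
  `ord₂(∏ θᵢ^{mᵢ} − 1) ≤ C(r)·∏ Aᵢ·(W + log 2Amax)`;
* `StepTwo C n α b V Vmax W` — the data of one Matveev step (the second branch of the dichotomy): some
  `r < n` and rank-`r` data satisfying every hypothesis of `CoreTwo C r`, with
  `ord₂(∏ αᵇ − 1) ≤ ord₂(∏ θᵐ − 1)` and the cost inequality;
* `DichotomyTwo C n` — for every rank-`n` datum: the bound, or `StepTwo`.

Theorems: `core_of_dichotomy` (strong induction on the rank), `dichotomyTwo_of_not_le` (the frame's
working form: assume the NEGATED bound, produce the step), `stepTwo_of_pow_eq` (the step from the algebraic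
relation `∏ θᵐ = (∏ αᵇ)^{m₀}`), and `engineTwo_of_core` — the frozen `GenThreeEngineTwo` text of the birth
skeleton (= hypothesis of `Summit.ABC.StewartYu.YuOhSeven.y07Two_of_genThreeEngineTwo`) VERBATIM from
`∀ r, CoreTwo C r` (drop integrality; `ℕ`-cube form ⇒ `ℤ` form by
`Summit.ABC.StewartYu.KummerBasisChange.kummerInt_of_kummerNat`).  So the registered stub
`stub_engineTwo : Nesterenko2003_prop51 → GenThreeEngineTwo` is reduced, in the kernel, to
`Nesterenko2003_prop51 → ∀ n, DichotomyTwo C n` for one admissible `C ≤ c₁ⁿ`: the analytic frame at rank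
`n` under the negated bound, ending in the step data.

WHAT THIS IS NOT: no analytic content; no crux moves; the cost inequality is the record's.

References: Yu. V. Nesterenko, *Linear forms in logarithms of rational numbers*, LNM 1819 (2003), Thm 2.1,
Prop. 2.6, §5.2 (5.22); K. Yu, *p-adic logarithmic forms and group varieties III*, Forum Math. 19 (2007),
Main Theorem (`K = ℚ`, `℘ = 2`); K. Yu, Acta Math. 211 (2013), §2 ("basic hypothesis"), §5.
-/

noncomputable section

open Finset

namespace Summit.ABC.StewartYu.GenThreeInductionTwo

/-! ### The rank-indexed internal statement and the step data (D-F1) -/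

/-- **The internal induction statement of the `p = 2` Gen-3 engine at rank `r`** (D-F1): for rational
`2`-adic principal units `θᵢ ≡ 1 (mod 8)`, multiplicatively independent and `3`-Kummer (`ℤ`-divisibility
form), weights `h(θᵢ) ≤ Aᵢ`, `1 ≤ Aᵢ ≤ Amax`, exponents `m ≠ 0` with `log max(3,|mᵢ|) ≤ W`, `1 ≤ W`:
`ord₂(∏ θᵢ^{mᵢ} − 1) ≤ C(r)·∏ Aᵢ·(W + log 2Amax)`. [cite: Yu2007, Main Thm (K = ℚ, ℘ = 2); shape only] -/
def CoreTwo (C : ℕ → ℝ) (r : ℕ) : Prop :=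
  ∀ (θ : Fin r → ℚ) (m : Fin r → ℤ) (A : Fin r → ℝ) (Amax W : ℝ),
    (∀ i, 3 ≤ padicValRat 2 (θ i - 1)) →
    (∀ μ : Fin r → ℤ, ∏ i, θ i ^ μ i = 1 → μ = 0) →
    (∀ κ : Fin r → ℤ, (∃ γ : ℚ, ∏ i, θ i ^ κ i = γ ^ 3) → ∀ i, (3 : ℤ) ∣ κ i) →
    (∀ i, Height.logHeight₁ (θ i) ≤ A i) → (∀ i, 1 ≤ A i) → (∀ i, A i ≤ Amax) →
    m ≠ 0 → (∀ i, Real.log (max 3 (|m i| : ℝ)) ≤ W) → 1 ≤ W →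
    (padicValRat 2 (∏ i, θ i ^ m i - 1) : ℝ) ≤ C r * (∏ i, A i) * (W + Real.log (2 * Amax))

/-- **The data of one Matveev step at rank `n`** (second branch of the dichotomy): a rank `r < n`, new
generators/exponents/weights satisfying every hypothesis of `CoreTwo C r`, the valuation comparison
`ord₂(∏ αᵇ − 1) ≤ ord₂(∏ θᵐ − 1)`, and the cost inequality
`C(r)·∏A′·(W′ + log 2A′max) ≤ C(n)·∏V·(W + log 2Vmax)`. [cite: Nesterenko2003, Prop 2.6 and (5.22)] -/
def StepTwo (C : ℕ → ℝ) (n : ℕ) (α : Fin n → ℚ) (b : Fin n → ℤ) (V : Fin n → ℝ) (Vmax W : ℝ) :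
    Prop :=
  ∃ (r : ℕ) (θ : Fin r → ℚ) (m : Fin r → ℤ) (A : Fin r → ℝ) (Amax W' : ℝ), r < n ∧
    (∀ i, 3 ≤ padicValRat 2 (θ i - 1)) ∧
    (∀ μ : Fin r → ℤ, ∏ i, θ i ^ μ i = 1 → μ = 0) ∧
    (∀ κ : Fin r → ℤ, (∃ γ : ℚ, ∏ i, θ i ^ κ i = γ ^ 3) → ∀ i, (3 : ℤ) ∣ κ i) ∧
    (∀ i, Height.logHeight₁ (θ i) ≤ A i) ∧ (∀ i, 1 ≤ A i) ∧ (∀ i, A i ≤ Amax) ∧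
    m ≠ 0 ∧ (∀ i, Real.log (max 3 (|m i| : ℝ)) ≤ W') ∧ 1 ≤ W' ∧
    padicValRat 2 (∏ j, α j ^ b j - 1) ≤ padicValRat 2 (∏ i, θ i ^ m i - 1) ∧
    C r * (∏ i, A i) * (W' + Real.log (2 * Amax)) ≤ C n * (∏ j, V j) * (W + Real.log (2 * Vmax))

/-- **The per-rank dichotomy** the analytic frame delivers at rank `n`: for every rank-`n` datum of
`CoreTwo`, the bound holds or a Matveev step exists. [cite: Nesterenko2003, Prop 2.6] -/
def DichotomyTwo (C : ℕ → ℝ) (n : ℕ) : Prop :=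
  ∀ (α : Fin n → ℚ) (b : Fin n → ℤ) (V : Fin n → ℝ) (Vmax W : ℝ),
    (∀ j, 3 ≤ padicValRat 2 (α j - 1)) →
    (∀ μ : Fin n → ℤ, ∏ j, α j ^ μ j = 1 → μ = 0) →
    (∀ κ : Fin n → ℤ, (∃ γ : ℚ, ∏ j, α j ^ κ j = γ ^ 3) → ∀ j, (3 : ℤ) ∣ κ j) →
    (∀ j, Height.logHeight₁ (α j) ≤ V j) → (∀ j, 1 ≤ V j) → (∀ j, V j ≤ Vmax) →
    b ≠ 0 → (∀ j, Real.log (max 3 (|b j| : ℝ)) ≤ W) → 1 ≤ W →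
    (padicValRat 2 (∏ j, α j ^ b j - 1) : ℝ) ≤ C n * (∏ j, V j) * (W + Real.log (2 * Vmax)) ∨
      StepTwo C n α b V Vmax W

/-! ### The induction -/

/-- **Matveev's induction on the number of logarithms**: the per-rank dichotomy for every rank gives the
internal statement for every rank (strong induction; the step closes by the induction hypothesis at the
smaller rank, the valuation comparison and the cost inequality). [cite: Nesterenko2003, Thm 2.1 from Prop 2.6] -/
theorem core_of_dichotomy {C : ℕ → ℝ} (hD : ∀ n, DichotomyTwo C n) : ∀ r, CoreTwo C r := by
  intro r
  induction r using Nat.strong_induction_on with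
  | _ n ih =>
    intro α b V Vmax W hα hind hK hV hV1 hVmax hb hW hW1
    rcases hD n α b V Vmax W hα hind hK hV hV1 hVmax hb hW hW1 with hle | hstep
    · exact hle
    · obtain ⟨r, θ, m, A, Amax, W', hr, hθ, hindθ, hKθ, hA, hA1, hAmax, hm, hW', hW1', hval, hcost⟩ :=
        hstep
      have hIH := ih r hr θ m A Amax W' hθ hindθ hKθ hA hA1 hAmax hm hW' hW1'
      have hval' : (padicValRat 2 (∏ j, α j ^ b j - 1) : ℝ) ≤
          (padicValRat 2 (∏ i, θ i ^ m i - 1) : ℝ) := by exact_mod_cast hval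
      exact hval'.trans (hIH.trans hcost)

/-- The frame's working form of the dichotomy: ASSUME the negated bound and produce the step.
[cite: Nesterenko2003, §5.2] -/
theorem dichotomyTwo_of_not_le {C : ℕ → ℝ} {n : ℕ}
    (h : ∀ (α : Fin n → ℚ) (b : Fin n → ℤ) (V : Fin n → ℝ) (Vmax W : ℝ),
      (∀ j, 3 ≤ padicValRat 2 (α j - 1)) →
      (∀ μ : Fin n → ℤ, ∏ j, α j ^ μ j = 1 → μ = 0) →
      (∀ κ : Fin n → ℤ, (∃ γ : ℚ, ∏ j, α j ^ κ j = γ ^ 3) → ∀ j, (3 : ℤ) ∣ κ j) →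
      (∀ j, Height.logHeight₁ (α j) ≤ V j) → (∀ j, 1 ≤ V j) → (∀ j, V j ≤ Vmax) →
      b ≠ 0 → (∀ j, Real.log (max 3 (|b j| : ℝ)) ≤ W) → 1 ≤ W →
      ¬ (padicValRat 2 (∏ j, α j ^ b j - 1) : ℝ) ≤ C n * (∏ j, V j) * (W + Real.log (2 * Vmax)) →
      StepTwo C n α b V Vmax W) :
    DichotomyTwo C n := by
  intro α b V Vmax W hα hind hK hV hV1 hVmax hb hW hW1
  by_cases hle : (padicValRat 2 (∏ j, α j ^ b j - 1) : ℝ) ≤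
      C n * (∏ j, V j) * (W + Real.log (2 * Vmax))
  · exact Or.inl hle
  · exact Or.inr (h α b V Vmax W hα hind hK hV hV1 hVmax hb hW hW1 hle)

/-! ### The valuation comparison from the algebraic relation `∏ θᵐ = (∏ αᵇ)^{m₀}` -/

/-- A rational `≡ 1 (mod 8)` is a `2`-adic unit. [folklore] -/
theorem padicValRat_eq_zero_of_three_le {x : ℚ} (h : 3 ≤ padicValRat 2 (x - 1)) :
    padicValRat 2 x = 0 := by
  have hx0 : x ≠ 0 := TwoSetup.ne_zero_of_three_le h
  have hx1 : x - 1 ≠ 0 := sub_ne_zero.mpr (TwoSetup.ne_one_of_three_le h)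
  -- `x = (x - 1) + 1`, `ord₂(x - 1) ≥ 3 > 0 = ord₂ 1`
  have hsum : x = (x - 1) + 1 := by ring
  have hne : padicValRat 2 (x - 1) ≠ padicValRat 2 (1 : ℚ) := by
    rw [padicValRat.one]; omega
  have hx0' : (x - 1) + 1 ≠ 0 := by rw [← hsum]; exact hx0
  have key := padicValRat.add_eq_min (p := 2) hx0' hx1 one_ne_zero hne
  rw [← hsum, padicValRat.one] at key
  rw [key]
  exact min_eq_right (by omega)

/-- Products of integer powers of rationals `≡ 1 (mod 8)` are `≡ 1 (mod 8)`:
`3 ≤ ord₂(∏ θᵢ^{mᵢ} − 1)` unless the product is `1`. Proof through `ℚ₂`: each `θᵢ` lies in the closed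
ball `‖u − 1‖ ≤ 8⁻¹`, a subgroup of `ℚ₂ˣ`. [cite: Yu1990, §1.1 (p = 2)] -/
theorem three_le_padicValRat_prod_zpow_sub_one {r : ℕ} (θ : Fin r → ℚ)
    (hθ : ∀ i, 3 ≤ padicValRat 2 (θ i - 1)) (m : Fin r → ℤ) (hne : ∏ i, θ i ^ m i ≠ 1) :
    3 ≤ padicValRat 2 (∏ i, θ i ^ m i - 1) := by
  -- ultrametric closure of the ball `‖u - 1‖ ≤ 8⁻¹` under products and integer powers, in `ℚ₂`
  have hball_mul : ∀ u v : ℚ_[2], ‖u - 1‖ ≤ (8 : ℝ)⁻¹ → ‖v - 1‖ ≤ (8 : ℝ)⁻¹ →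
      ‖u * v - 1‖ ≤ (8 : ℝ)⁻¹ := by
    intro u v hu hv
    have hv1 : ‖v‖ ≤ 1 := by
      have : v = (v - 1) + 1 := by ring
      rw [this]
      refine (IsUltrametricDist.norm_add_le_max _ _).trans ?_
      rw [norm_one]; exact max_le (hv.trans (by norm_num)) le_rfl
    have hsplit : u * v - 1 = (u - 1) * v + (v - 1) := by ring
    rw [hsplit]
    refine (IsUltrametricDist.norm_add_le_max _ _).trans (max_le ?_ hv)
    rw [norm_mul]
    calc ‖u - 1‖ * ‖v‖ ≤ (8 : ℝ)⁻¹ * 1 :=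
          mul_le_mul hu hv1 (norm_nonneg _) (by norm_num)
      _ = (8 : ℝ)⁻¹ := by ring
  have hball_inv : ∀ u : ℚ_[2], ‖u - 1‖ ≤ (8 : ℝ)⁻¹ → ‖u⁻¹ - 1‖ ≤ (8 : ℝ)⁻¹ := by
    intro u hu
    have hu0 : u ≠ 0 := by
      intro h0; rw [h0, zero_sub, norm_neg, norm_one] at hu; norm_num at hu
    have hnu : ‖u‖ = 1 := by
      have h1 : ‖u‖ ≤ 1 := by
        have : u = (u - 1) + 1 := by ring
        rw [this]
        refine (IsUltrametricDist.norm_add_le_max _ _).trans ?_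
        rw [norm_one]; exact max_le (hu.trans (by norm_num)) le_rfl
      have h2 : 1 ≤ ‖u‖ := by
        by_contra hlt
        push Not at hlt
        -- `‖1‖ ≤ max ‖1 - u‖ ‖u‖ < 1`
        have h3 : ‖-(u - 1) + u‖ ≤ max ‖-(u - 1)‖ ‖u‖ := IsUltrametricDist.norm_add_le_max _ _
        have e1 : -(u - 1) + u = (1 : ℚ_[2]) := by ring
        rw [e1, norm_one, norm_neg] at h3
        have h4 : max ‖u - 1‖ ‖u‖ < 1 := max_lt (hu.trans_lt (by norm_num)) hlt
        linarith
      exact le_antisymm h1 h2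
    have : u⁻¹ - 1 = -(u⁻¹ * (u - 1)) := by field_simp; ring
    rw [this, norm_neg, norm_mul, norm_inv, hnu, inv_one, one_mul]
    exact hu
  have hball_zpow : ∀ (u : ℚ_[2]) (k : ℤ), ‖u - 1‖ ≤ (8 : ℝ)⁻¹ → ‖u ^ k - 1‖ ≤ (8 : ℝ)⁻¹ := by
    intro u k hu
    have hpow : ∀ n : ℕ, ‖u ^ n - 1‖ ≤ (8 : ℝ)⁻¹ := by
      intro n
      induction n with
      | zero => simp
      | succ n ih => rw [pow_succ]; exact hball_mul _ _ ih hu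
    rcases Int.eq_nat_or_neg k with ⟨n, rfl | rfl⟩
    · rw [zpow_natCast]; exact hpow n
    · rw [zpow_neg, zpow_natCast]; exact hball_inv _ (hpow n)
  have hball_prod : ‖((∏ i, θ i ^ m i : ℚ) : ℚ_[2]) - 1‖ ≤ (8 : ℝ)⁻¹ := by
    push_cast
    have : ∀ s : Finset (Fin r), ‖∏ i ∈ s, ((θ i : ℚ) : ℚ_[2]) ^ m i - 1‖ ≤ (8 : ℝ)⁻¹ := by
      intro s
      induction s using Finset.induction_on with
      | empty => simp
      | insert i s hi ih =>
        rw [Finset.prod_insert hi]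
        refine hball_mul _ _ (hball_zpow _ _ ?_) ih
        have h := TwoAdic.norm_one_sub_le_eighth (hθ i)
        rwa [← norm_neg, neg_sub] at h
    exact this Finset.univ
  -- back to `padicValRat`
  set x : ℚ := ∏ i, θ i ^ m i with hxdef
  have hx1 : x - 1 ≠ 0 := sub_ne_zero.mpr hne
  have hnorm : ‖((x - 1 : ℚ) : ℚ_[2])‖ ≤ (8 : ℝ)⁻¹ := by push_cast; exact hball_prod
  haveI : Fact (Nat.Prime 2) := ⟨Nat.prime_two⟩
  rw [Padic.norm_eq_zpow_neg_valuation (by exact_mod_cast hx1), Padic.valuation_ratCast] at hnorm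
  -- `2^{-v} ≤ 8⁻¹ = 2^{-3}` ⇒ `3 ≤ v`
  by_contra hlt
  push Not at hlt
  have h1 : (-3 : ℤ) < -padicValRat 2 (x - 1) := by omega
  have h2 : ((2 : ℕ) : ℝ) ^ (-3 : ℤ) < ((2 : ℕ) : ℝ) ^ (-padicValRat 2 (x - 1)) :=
    zpow_lt_zpow_right₀ (by norm_num) h1
  have h3 : ((2 : ℕ) : ℝ) ^ (-3 : ℤ) = (8 : ℝ)⁻¹ := by norm_num
  have h4 : ((2 : ℕ) : ℝ) ^ (-3 : ℤ) < (8 : ℝ)⁻¹ := h2.trans_le hnorm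
  rw [h3] at h4
  exact lt_irrefl _ h4

/-- **The valuation comparison of a Matveev step**: if `∏ θᵢ^{mᵢ} = (∏ αⱼ^{bⱼ})^{m₀}` with `m₀ ≠ 0`,
the `αⱼ` are `≡ 1 (mod 8)`, multiplicatively independent, and `b ≠ 0`, then
`ord₂(∏ αᵇ − 1) ≤ ord₂(∏ θᵐ − 1)` (`x = ∏ αᵇ` is a `2`-adic unit `≠ ±1`, so `x^{m₀} ≠ 1`, and
`ord₂(x − 1) ≤ ord₂(x^{m₀} − 1)`). [cite: Nesterenko2003, Prop 2.6 (2.13)] -/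
theorem padicValRat_le_of_pow_eq {n r : ℕ} (α : Fin n → ℚ) (hα : ∀ j, 3 ≤ padicValRat 2 (α j - 1))
    (hind : ∀ μ : Fin n → ℤ, ∏ j, α j ^ μ j = 1 → μ = 0) (b : Fin n → ℤ) (hb : b ≠ 0)
    (θ : Fin r → ℚ) (m : Fin r → ℤ) (m₀ : ℤ) (hm₀ : m₀ ≠ 0)
    (hrel : ∏ i, θ i ^ m i = (∏ j, α j ^ b j) ^ m₀) :
    padicValRat 2 (∏ j, α j ^ b j - 1) ≤ padicValRat 2 (∏ i, θ i ^ m i - 1) := by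
  set x : ℚ := ∏ j, α j ^ b j with hxdef
  have hα0 : ∀ j, α j ≠ 0 := fun j => TwoSetup.ne_zero_of_three_le (hα j)
  have hx0 : x ≠ 0 := Finset.prod_ne_zero_iff.mpr fun j _ => zpow_ne_zero _ (hα0 j)
  -- `x` is a `2`-adic unit
  have hxv : padicValRat 2 x = 0 := by
    by_cases hx1 : x = 1
    · rw [hx1, padicValRat.one]
    · exact padicValRat_eq_zero_of_three_le
        (three_le_padicValRat_prod_zpow_sub_one α hα b hx1)
  -- `x^{m₀} ≠ 1`: otherwise `∏ α^{m₀ b} = 1`, so `m₀ b = 0`, so `b = 0`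
  have hxm : x ^ m₀ ≠ 1 := by
    intro h1
    have h2 : ∏ j, α j ^ (m₀ * b j) = 1 := by
      rw [← h1, hxdef, ← Finset.prod_zpow]
      refine Finset.prod_congr rfl fun j _ => ?_
      rw [← zpow_mul, mul_comm]
    have h3 := hind (fun j => m₀ * b j) h2
    apply hb
    funext j
    have h4 := congrFun h3 j
    simp only [Pi.zero_apply, mul_eq_zero] at h4
    rcases h4 with h4 | h4
    · exact absurd h4 hm₀
    · exact h4
  rw [hrel]
  exact Literature.Barriers.ABC.padicValRat_sub_one_le_zpow_sub_one hx0 hxv hm₀ hxm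

/-- **The step from the algebraic relation**: rank-`r` data (`r < n`) satisfying the hypotheses of
`CoreTwo C r`, the relation `∏ θᵐ = (∏ αᵇ)^{m₀}` (`m₀ ≠ 0`) and the cost inequality give `StepTwo`.
This is the form in which the frame's END (zero estimate ∘ `ZeroEnd.zeroEnd` ∘
`MatveevStepData.exists_matveev_step_data`, `θᵢ = ∏ αⱼ^{Zᵢⱼ}`, `m₀ b = ∑ mᵢ Zᵢ`) produces it.
[cite: Nesterenko2003, Prop 2.6 (2.9)–(2.13)] -/
theorem stepTwo_of_pow_eq {C : ℕ → ℝ} {n : ℕ} {α : Fin n → ℚ} {b : Fin n → ℤ} {V : Fin n → ℝ}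
    {Vmax W : ℝ} (hα : ∀ j, 3 ≤ padicValRat 2 (α j - 1))
    (hind : ∀ μ : Fin n → ℤ, ∏ j, α j ^ μ j = 1 → μ = 0) (hb : b ≠ 0)
    {r : ℕ} (hr : r < n) (θ : Fin r → ℚ) (m : Fin r → ℤ) (A : Fin r → ℝ) (Amax W' : ℝ)
    (hθ : ∀ i, 3 ≤ padicValRat 2 (θ i - 1))
    (hindθ : ∀ μ : Fin r → ℤ, ∏ i, θ i ^ μ i = 1 → μ = 0)
    (hKθ : ∀ κ : Fin r → ℤ, (∃ γ : ℚ, ∏ i, θ i ^ κ i = γ ^ 3) → ∀ i, (3 : ℤ) ∣ κ i)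
    (hA : ∀ i, Height.logHeight₁ (θ i) ≤ A i) (hA1 : ∀ i, 1 ≤ A i) (hAmax : ∀ i, A i ≤ Amax)
    (hW' : ∀ i, Real.log (max 3 (|m i| : ℝ)) ≤ W') (hW1' : 1 ≤ W')
    (m₀ : ℤ) (hm₀ : m₀ ≠ 0) (hrel : ∏ i, θ i ^ m i = (∏ j, α j ^ b j) ^ m₀)
    (hcost : C r * (∏ i, A i) * (W' + Real.log (2 * Amax)) ≤
      C n * (∏ j, V j) * (W + Real.log (2 * Vmax))) :
    StepTwo C n α b V Vmax W := by
  -- `m ≠ 0`: otherwise `(∏ αᵇ)^{m₀} = 1`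
  have hm : m ≠ 0 := by
    intro hm0
    have h1 : (∏ j, α j ^ b j) ^ m₀ = 1 := by
      rw [← hrel, hm0]; simp
    have hle := padicValRat_le_of_pow_eq α hα hind b hb θ m m₀ hm₀ hrel
    -- with `m = 0` the right side is `ord₂ 0 = 0` while the left side is `≥ 3`
    rw [hm0] at hle
    simp only [Pi.zero_apply, zpow_zero, Finset.prod_const_one, sub_self, padicValRat.zero] at hle
    have hne : ∏ j, α j ^ b j ≠ 1 := by
      intro h; apply hb; exact hind b h
    have h3 := three_le_padicValRat_prod_zpow_sub_one α hα b hne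
    omega
  exact ⟨r, θ, m, A, Amax, W', hr, hθ, hindθ, hKθ, hA, hA1, hAmax, hm, hW', hW1',
    padicValRat_le_of_pow_eq α hα hind b hb θ m m₀ hm₀ hrel, hcost⟩

/-! ### The frozen engine text from the core -/

/-- **The frozen crux-side engine text `GenThreeEngineTwo` from the internal statement**: the text of the
birth skeleton of `Y07Two` (= the hypothesis of `Summit.ABC.StewartYu.YuOhSeven.y07Two_of_genThreeEngineTwo`)
is the `r = m` instance of `CoreTwo` — integrality is dropped and the `ℕ`-contrapositive cube-Kummer
hypothesis is turned into the `ℤ`-divisibility form by `KummerBasisChange.kummerInt_of_kummerNat`.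
[cite: Yu2007, Main Thm (K = ℚ, ℘ = 2); shape only] -/
theorem engineTwo_of_core {C : ℕ → ℝ} {c₁ : ℝ} (hc₁ : 1 ≤ c₁) (hC : ∀ m, 0 ≤ C m ∧ C m ≤ c₁ ^ m)
    (hcore : ∀ r, CoreTwo C r) :
    ∃ (C : ℕ → ℝ) (c₁ : ℝ), 1 ≤ c₁ ∧ (∀ m, 0 ≤ C m ∧ C m ≤ c₁ ^ m) ∧
      ∀ (m : ℕ) (α : Fin m → ℚ) (b : Fin m → ℤ) (V : Fin m → ℝ) (Vmax W : ℝ),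
        (∀ j, ∃ a : ℤ, α j = a) →
        (∀ j, 3 ≤ padicValRat 2 (α j - 1)) →
        (∀ μ : Fin m → ℤ, ∏ j, α j ^ μ j = 1 → μ = 0) →
        (∀ κ : Fin m → ℕ, (∃ j, ¬ 3 ∣ κ j) → ∀ γ : ℚ, ∏ j, α j ^ κ j ≠ γ ^ 3) →
        (∀ j, Height.logHeight₁ (α j) ≤ V j) → (∀ j, 1 ≤ V j) → (∀ j, V j ≤ Vmax) →
        b ≠ 0 → (∀ j, Real.log (max 3 (|b j| : ℝ)) ≤ W) → 1 ≤ W →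
        (padicValRat 2 (∏ j, α j ^ b j - 1) : ℝ) ≤ C m * (∏ j, V j) * (W + Real.log (2 * Vmax)) := by
  refine ⟨C, c₁, hc₁, hC, ?_⟩
  intro m α b V Vmax W _hint hα hind hK hV hV1 hVmax hb hW hW1
  have hα0 : ∀ j, α j ≠ 0 := fun j => TwoSetup.ne_zero_of_three_le (hα j)
  have hKZ : ∀ κ : Fin m → ℤ, (∃ γ : ℚ, ∏ j, α j ^ κ j = γ ^ 3) → ∀ j, (3 : ℤ) ∣ κ j := by
    have h := KummerBasisChange.kummerInt_of_kummerNat 3 (by norm_num) α hα0 hK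
    intro κ hκ j
    exact_mod_cast h κ hκ j
  exact hcore m α b V Vmax W hα hind hKZ hV hV1 hVmax hb hW hW1

/-- **Reduction of the registered stub**: `stub_engineTwo : Nesterenko2003_prop51 → GenThreeEngineTwo` follows
from ONE admissible constant function `C ≤ c₁ⁿ` for which the zero estimate yields the per-rank dichotomy at
every rank. [cite: Nesterenko2003, Thm 2.1 from Prop 2.6] -/
theorem engineTwo_of_dichotomy {Z : Prop} {C : ℕ → ℝ} {c₁ : ℝ} (hc₁ : 1 ≤ c₁)
    (hC : ∀ m, 0 ≤ C m ∧ C m ≤ c₁ ^ m) (hD : Z → ∀ n, DichotomyTwo C n) (hZ : Z) :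
    ∃ (C : ℕ → ℝ) (c₁ : ℝ), 1 ≤ c₁ ∧ (∀ m, 0 ≤ C m ∧ C m ≤ c₁ ^ m) ∧
      ∀ (m : ℕ) (α : Fin m → ℚ) (b : Fin m → ℤ) (V : Fin m → ℝ) (Vmax W : ℝ),
        (∀ j, ∃ a : ℤ, α j = a) →
        (∀ j, 3 ≤ padicValRat 2 (α j - 1)) →
        (∀ μ : Fin m → ℤ, ∏ j, α j ^ μ j = 1 → μ = 0) →
        (∀ κ : Fin m → ℕ, (∃ j, ¬ 3 ∣ κ j) → ∀ γ : ℚ, ∏ j, α j ^ κ j ≠ γ ^ 3) →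
        (∀ j, Height.logHeight₁ (α j) ≤ V j) → (∀ j, 1 ≤ V j) → (∀ j, V j ≤ Vmax) →
        b ≠ 0 → (∀ j, Real.log (max 3 (|b j| : ℝ)) ≤ W) → 1 ≤ W →
        (padicValRat 2 (∏ j, α j ^ b j - 1) : ℝ) ≤ C m * (∏ j, V j) * (W + Real.log (2 * Vmax)) :=
  engineTwo_of_core hc₁ hC (core_of_dichotomy (hD hZ))

end Summit.ABC.StewartYu.GenThreeInductionTwo

end
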